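import Literature.NumberTheory.LFunctions.Zhang2022.RepairRplusPlus4
import Literature.NumberTheory.LFunctions.Zhang2022.RepairBlenLambdaWhole
import Literature.NumberTheory.LFunctions.Zhang2022.RepairDetEntangled
import Literature.NumberTheory.LFunctions.Zhang2022.RepairIntakeBdet
import Literature.NumberTheory.LFunctions.Zhang2022.RepairRplusBandMV

/-!
# Zhang (2022) §18-margin repair rung — THE RUNNING ASSEMBLY `R⁺⁺`, continuation file (versions 12, …)

Trunk T-ANT (NumberTheory/LFunctions). Y. Zhang, *Discrete mean estimates and the Landau–Siegel
zero*, arXiv:2211.02515v1 (2022) [Zhang2022LandauSiegel] — **an unrefereed manuscript under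
adjudication. WHAT THIS IS NOT: nothing here asserts or denies its Theorems 1–2 or any analytic lemma;
no claim about Landau–Siegel zeros, about Parity, or about a repaired `Margin232` is made. Every
statement is about the manuscript's METHOD AS ARCHITECTED — classes of designs fed to the SAME main-term
calculus (or to a displayed MODEL main term) — not about zeros of `L`-functions.** Cell `landau-siegel`
(rung F-S3), sub-cell E, seat p1 (generation g2), stub S-E-p1-1 «running assembly» of barrier/ASSIGNMENTS.md.

Continuation of `RepairRplusPlus` (versions 0–3), `RepairRplusPlus2` (4–6 + addendum), `RepairRplusPlus3` (7–8) and
`RepairRplusPlus4` (9–11; class of record before this file = `Repair.Rplusplus11`, p473293, 38 families, with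
`rplusplus11_words_sub` = the B-multi intake v6 and the B-len intake v3 as sub-lists); those files reached their line
budget. Same protocol (`Repair.DesignFamily`, `ClassDecided`, append-only versions `Rplusplus<k>`, class OF RECORD =
the last version, named in barrier/BARRIER-STATE.md; per version: `Rplusplus<k>`, `rplusplus<k>_decided` by
`classDecided_append` — nothing re-proved —, `mem_rplusplus<k>_iff`, the prefix lemma, the sub-list recoveries, the
intake lists of record as sub-lists, the unbundled verdicts, the table rows in a `/-! ### Version k -/` section).

## Class table — version 12 (rows 39–40; rows 1–14 `RepairRplusPlus`, 15–21 `RepairRplusPlus2`, 22–33 `RepairRplusPlus3`,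
## 34–38 `RepairRplusPlus4`) — and the THIRD design-class word's intake inside the class of record

| # | family (decl) | designs, K in words | V (currency) | displayed inputs (kind) | p-id (file) | non-vacuity / tightness / embeddings |
|---|---|---|---|---|---|---|
| 39 «(L-b)∣Λ whole range» | `familyLambdaWholeAll` | `LambdaWholeDesign (θ, u, u′, L, v′, c)`: `KinkedProfile u u′`, `u(1) = 0`, ONE Λ-type piece on the WHOLE range `[0, θ]`, `θ > 1` (`L.Whole θ v′`: order `k ≥ 1`, top `= θ`, profile continuous on `[0,1)` and on `[1,θ]`, right-differentiable off `1` with `L²` marked derivative on each part, bounded — NO vanishing below the wall), amplitude `c` — the B-len (L-b) parenthesis «(or whole profile [0, θ])» (sub-word u6 of RepairIntakeBlen: 0 design rows of record); ⊇ row 25's class (`LambdaPiece.Overhang.whole`, `LambdaOverhangDesign.InClass.toWhole`) | MODEL currency (E-070/E-071 on the whole range): in EVERY world `(K, X)`, `LambdaWholeDiagNonneg θ K → LambdaWholeCS θ K X → ¬ (lambdaBlockMainTerm K X u u′ L c < 0)` | as WORLD binders: `KnifeEdge.LambdaWholeDiagNonneg θ K` · `KnifeEdge.LambdaWholeCS θ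 K X` (kind (c); the SAME slots as rows 25–26 RE-QUANTIFIED over the larger piece class, hence STRONGER hypotheses: `LambdaWholeDiagNonneg.overhang`, `LambdaWholeCS.overhang`) | p474795 (`RepairBlenLambdaWhole`, ls-Blen-typer-1 g3, S-E-bt1-3; GO ls-barrier-plan g1 23:12:38Z (2); REF-E candidate E-21) ← p467353, p459168 | rider (r1) DECLARED: class WIDER ⇒ slots STRONGER ⇒ per design a WEAKER theorem than rows 25–26 on their common members; coverage CONDITIONAL «GIVEN B-AH (E-014)» and counted ONCE (the overhang rows keep their members); exact criterion `eLambdaWholeCloses_iff_indefinite` / `lambdaWholeNull_iff` (T-6 twin); kernel mode `eLambdaWholeCloses_of_kernelMode`; C4 `inClass_lenLamWholeArch` (polynomial arch on `[0,θ]` over `ϰ(1,k)`), `inClass_lenLamBump_toWhole`; disjoint from M2 `not_admissible_of_whole`; whether it is also a `blenWord4` constructor `lamWhole` is ls-Blen-plan g3's call (rider (r2)) — a row here either way |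
| 40 «det entangled» | `familyDetEntangled` | `DetEntangledDesign (K, a, b, h, h′)`: an ENTANGLED class-DET detector (widened clause (i′) of the B-det word) — anchor shift multiple `a ∈ (0,1)`, palette `b : Fin K → (0,5)` (Part-III contour box), profile vector `h` of ONE-SIDED kinked profiles vanishing at the top (`KinkedProfile (h j) (h′ j)`, `h j 1 = 0`); NO analytic hypothesis | block-form / main-term currency (POS endgame): `ConePSD a b → ¬ (Re entangledMain a b h h′ < 0)` | ONE slot, kind (c): the E-102 MEMBER `Det.ConePSD d.a d.b` (the block moment matrix of the anchor and palette is PSD on one-sided kinked profiles) — displayed, never in the class; GIVEN the registry row E-102 `Det.EdetCone (Set.Ioo 0 1) (Set.Ioo 0 5)` (det-E15 on the continuum, p473997) EVERY member's slot is discharged (`detEntangled_verdict_of_edetCone`) | p475645 (`RepairDetEntangled`, ls-Bdet-typer-2 g2; GO ls-barrier-plan g1 23:38:57Z (2); REF-E candidate E-22) ← p473997 (`DetectorEntangledCone`) | CONDITIONAL «GIVEN E-102» (displayed), coverage counted once, never «PSD certified»; C2 `K = 1` = the repeated-shift monomials via `conePSD_fin_one_iff` (`detEntangled_verdict_fin_one`);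 C4 the SOS cell by term (`sosCell`, `inClass_sosCell`, `sosCellHalf23` / `inClass_sosCellHalf23` / `verdict_sosCellHalf23`, `mainTerm_sosCell_re`); the B-det intake lists it in `bdetWord2` (Part 2, after INTAKE-4 v1) ⇒ `bdetWord2_sub_rplusplus13` then |

**KILL(B-det) — the third design-class word, OF RECORD 2026-08-26T23:09:45Z (director-frontier g6)**, VERBATIM: «KILL(B-det)
INSIDE DET: decided on the scanned generators (sign-admissible monomials; SOS rank-one slices; two-profile entangled pairs —
certified two-lineage), full palette PSD-up-to-ε with a structural kernel and no negative direction, GIVEN det-E15 E-det-cone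
(E-102) on the continuum.» (READY-FOR-WORD ls-Bdet-plan 23:04:30Z over KILL-draft v1.8 a515c90d58d0257f; REF-B1 fold verified
23:15:55Z; ls-barrier-plan g1 RULING 23:22:50Z «INTAKE-4»). Its intake `Repair.bdetWord = [familyDetShift, familyH1,
familyRCalc]` (RepairIntakeBdet, p476156, S-E-bdet-1, ls-Bmulti-typer-2 g3; sum family `familyBdet` with constructors `w2` ↦ row 17
`familyDetShift` — CONDITIONAL on E-010 `Det.FormDetPSD (shiftRecipe b)` off the discharged triples `(1,2,3)` / `(½; 2, 5/2)`,
«GIVEN E-102» in every citation —, `stdLegs` ↦ row 2 `familyH1`, `w1calc` ↦ row 6 `familyRCalc`) consists of rows ALREADY in the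
class since version 4: the word adds NO row; it is recorded as the third sub-list (`bdetWord_sub_rplusplus12`,
`rplusplus12_words_sub`, `rplus_threeWords_asFamilies_decided`). NOT rows (never listed): the sum families `familyBmulti6` /
`familyBlen3` / `familyBdet` (they ARE the words: listing them would double-count their constructors' rows), `bfamWord` /
`familyBfam*` (KILL(B-fam): a separate decided class, disjoint by declaration), `DH.menuConsistent_holds` (KILL(B-dh): a target,
not a family). The §6 D1 sentence of record is ls-barrier-p5 g3's `Repair.doneCondition_v<k>` (RepairDoneCondition.lean),
which consumes `rplusplus<k>_decided` and the `_sub_` lemmas of this assembly.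

## References

* Y. Zhang, arXiv:2211.02515v1 (2022), §2 Lemma 2.3, Props. 2.4–2.6, (2.13), (2.16)–(2.20), (2.23)–(2.33) [p. 4–11],
  §7 Prop. 7.1, (7.2) [p. 44], §8 Lemma 8.1. [cite: Zhang2022LandauSiegel, §§2, 7, 8]
* R. Horn, C. Johnson, *Matrix Analysis*, 2nd ed., Thm 7.2.5. [cite: HornJohnson2013, Thm 7.2.5]
-/

noncomputable section

open scoped ComplexOrder NNReal

namespace Literature.NumberTheory.LFunctions.Zhang2022

namespace Repair

/-! ### Version 12 (2026-08-26): the whole-range Λ row; the KILL(B-det) intake inside the class of record -/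

/-- **`R⁺⁺`, version 12**: version 11 (`RepairRplusPlus4.Rplusplus11`, 38 families) followed by the whole-range
(L-b)∣Λ family (`familyLambdaWholeAll`, p474795) — row 39 — and the entangled class-DET detector family (`familyDetEntangled`,
ls-Bdet-typer-2 g2) — row 40. The KILL(B-det) intake v1 adds no row (its three families are rows 17 / 2 / 6). [cite: Zhang2022LandauSiegel, §2 (2.32)–(2.33); §7 Prop 7.1 (7.2) p.44] -/
def Rplusplus12 : List DesignFamily := Rplusplus11 ++ [familyLambdaWholeAll, familyDetEntangled]

/-- **Version 12 is decided**: `rplusplus11_decided` for rows 1–38, `familyLambdaWholeAll_decided` (p474795) for row 39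
and `familyDetEntangled_decided` for row 40; nothing re-proved.
[cite: Zhang2022LandauSiegel, §2 Props. 2.4–2.6, (2.16), (2.32)–(2.33); §7 (7.2) p.44] -/
theorem rplusplus12_decided : ClassDecided Rplusplus12 :=
  classDecided_append.2 ⟨rplusplus11_decided,
    classDecided_cons familyLambdaWholeAll_decided <| classDecided_cons familyDetEntangled_decided classDecided_nil⟩

/-- The families of version 12, by name (the class is EXACTLY these forty).
[cite: Zhang2022LandauSiegel, §2 (2.32)–(2.33)] -/
theorem mem_rplusplus12_iff (F : DesignFamily) :
    F ∈ Rplusplus12 ↔ F = familyR ∨ F = familyH1 ∨ F = familyTwoPiece ∨ F = familyFarPiece ∨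
      F = familyRWide ∨ F = familyRCalc ∨ F = KnifeEdge.familyRoughTwoPiece ∨ F = familyRLengths ∨
      F = familySmoothLengths ∨ F = familySmoothTop ∨ F = familyTwoPieceJoint ∨ F = familyWallZero ∨
      F = familyWallZeroTop ∨ F = familyInPrintLen ∨ F = KnifeEdge.familyWallBand ∨ F = familyJumpBlockAll ∨
      F = familyDetShift ∨ F = KnifeEdge.familyRoughThreePiece ∨ F = KnifeEdge.familyRoughTwoPieceJoint ∨
      F = familyFarBV ∨ F = familyLambdaBlockAll ∨ F = familyWallZeroMain ∨ F = familyWallZeroTopMain ∨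
      F = KnifeEdge.familyGramBlockAll ∨ F = familyLambdaOverhangAll ∨ F = familyLambdaGradedAll ∨
      F = KnifeEdge.familyGramBlockDict ∨ F = KnifeEdge.familyGramBordered ∨ F = familyMuPsiOverhangAll ∨
      F = familyNuOverhangAll ∨ F = familyBandEdge ∨ F = familySmoothBandEdge ∨ F = familySmoothTopBandEdge ∨
      F = familyNuLipOverhangAll ∨ F = familyWallZeroTrueBand ∨ F = familyWallZeroTopTrueBand ∨
      F = familySmoothWallZeroTrueBand ∨ F = familySmoothTopWallZeroTrueBand ∨ F = familyLambdaWholeAll ∨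
      F = familyDetEntangled := by
  simp only [Rplusplus12, Rplusplus11, Rplusplus10, Rplusplus9, Rplusplus8, Rplusplus7, Rplusplus6, Rplusplus5,
    Rplusplus4, Rplusplus3, Rplusplus2, Rplusplus1, Rplus, List.cons_append, List.nil_append, List.mem_cons,
    List.not_mem_nil, or_false]

/-- **Version 11 ⊆ version 12** (list prefix: no family dropped). [cite: Zhang2022LandauSiegel, §2 (2.32)–(2.33)] -/
theorem rplusplus11_sub_rplusplus12 : ∀ F ∈ Rplusplus11, F ∈ Rplusplus12 :=
  fun _ hF => List.mem_append.2 (Or.inl hF)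

/-- `R⁺ ⊆` version 12. [cite: Zhang2022LandauSiegel, §2 (2.32)–(2.33)] -/
theorem rplus_sub_rplusplus12 : ∀ F ∈ Rplus, F ∈ Rplusplus12 :=
  fun F hF => rplusplus11_sub_rplusplus12 F (rplus_sub_rplusplus11 F hF)

/-- Version 12 restricted to version 11, and the slice files' own `R⁺ ++ [familyLambdaWholeAll]`
(`rplus_lambdaWholeAll_decided`) and `R⁺ ++ [familyDetEntangled]` (`rplus_detEntangled_decided`) as sub-lists.
[cite: Zhang2022LandauSiegel, §2 (2.32)–(2.33)] -/
theorem rplusplus12_decided_sublists :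
    ClassDecided Rplusplus11 ∧ ClassDecided (Rplus ++ [familyLambdaWholeAll]) ∧
      ClassDecided (Rplus ++ [familyDetEntangled]) := by
  refine ⟨rplusplus12_decided.mono rplusplus11_sub_rplusplus12, rplusplus12_decided.mono fun F hF => ?_,
    rplusplus12_decided.mono fun F hF => ?_⟩ <;>
  · simp only [Rplus, List.cons_append, List.nil_append, List.mem_cons, List.not_mem_nil, or_false,
      mem_rplusplus12_iff] at hF ⊢
    tauto

/-- **The KILL(B-det) intake list is inside version 12** — rows 17 / 2 / 6: `familyDetShift`, `familyH1`, `familyRCalc`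
(RepairIntakeBdet `bdetWord`). [cite: Zhang2022LandauSiegel, §2 (2.13), Lemma 2.3, (2.32)–(2.33)] -/
theorem bdetWord_sub_rplusplus12 : ∀ F ∈ bdetWord, F ∈ Rplusplus12 := by
  intro F hF
  simp only [bdetWord, List.mem_cons, List.not_mem_nil, or_false] at hF
  rw [mem_rplusplus12_iff]
  tauto

/-- … hence `bdetWord_decided` is an instance of `rplusplus12_decided` (the word's class is decided BECAUSE the class of
record is). [cite: Zhang2022LandauSiegel, §2 (2.32)–(2.33)] -/
theorem rplusplus12_decided_bdetWord : ClassDecided bdetWord := rplusplus12_decided.mono bdetWord_sub_rplusplus12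

/-- **All three design-class words' intake lists of record are inside version 12**: B-multi v6 (`bmultiWord6`), B-len v3
(`blenWord3`), B-det (`bdetWord`). [cite: Zhang2022LandauSiegel, §2 (2.32)–(2.33); §7 Prop 7.1 (7.2) p.44] -/
theorem rplusplus12_words_sub :
    (∀ F ∈ bmultiWord6, F ∈ Rplusplus12) ∧ (∀ F ∈ blenWord3, F ∈ Rplusplus12) ∧ (∀ F ∈ bdetWord, F ∈ Rplusplus12) :=
  ⟨fun F hF => rplusplus11_sub_rplusplus12 F (rplusplus11_words_sub.1 F hF),
    fun F hF => rplusplus11_sub_rplusplus12 F (rplusplus11_words_sub.2 F hF), bdetWord_sub_rplusplus12⟩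

/-- … so the union of the three intake lists is decided, as a sub-list of version 12.
[cite: Zhang2022LandauSiegel, §2 (2.32)–(2.33)] -/
theorem rplusplus12_decided_threeWords : ClassDecided (bmultiWord6 ++ blenWord3 ++ bdetWord) := by
  refine rplusplus12_decided.mono fun F hF => ?_
  rcases List.mem_append.1 hF with h | h
  · rcases List.mem_append.1 h with h' | h'
    · exact rplusplus12_words_sub.1 F h'
    · exact rplusplus12_words_sub.2.1 F h'
  · exact rplusplus12_words_sub.2.2 F h

/-- … and the three words as ONE family each (the sum families, never rows): `R⁺ ++ [familyBmulti6, familyBlen3,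
familyBdet]` is decided — cited by term from the intake files. [cite: Zhang2022LandauSiegel, §2 (2.32)–(2.33)] -/
theorem rplus_threeWords_asFamilies_decided : ClassDecided (Rplus ++ [familyBmulti6, familyBlen3, familyBdet]) :=
  classDecided_append.2 ⟨rplus_decided, classDecided_cons familyBmulti6_decided <|
    classDecided_cons familyBlen3_decided <| classDecided_cons familyBdet_decided classDecided_nil⟩

/-- **The KILL(B-len) intake list v4 is inside version 12**: `blenWord4 = blenWord3 ++ [familyLambdaWholeAll]` (RepairIntakeBlen
Part 7, constructor `lamWhole` per ls-Blen-plan g3 23:53:33Z) — row 39 is exactly its new family.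
[cite: Zhang2022LandauSiegel, §2 (2.32)–(2.33); §7 Prop 7.1 (7.2) p.44] -/
theorem blenWord4_sub_rplusplus12 : ∀ F ∈ blenWord4, F ∈ Rplusplus12 := by
  intro F hF
  rcases List.mem_append.1 hF with h | h
  · exact rplusplus11_sub_rplusplus12 F (rplusplus11_words_sub.2 F h)
  · simp only [List.mem_cons, List.not_mem_nil, or_false] at h
    rw [mem_rplusplus12_iff]
    tauto

/-- … hence `blenWord4_decided` is an instance of `rplusplus12_decided`. [cite: Zhang2022LandauSiegel, §2 (2.32)–(2.33)] -/
theorem rplusplus12_decided_blenWord4 : ClassDecided blenWord4 := rplusplus12_decided.mono blenWord4_sub_rplusplus12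

/-- **Unbundled reading of row 39** (every binder literal): for every whole-range design and every model world carrying
the two (re-quantified) slots, the member's model constant is not negative.
[cite: Zhang2022LandauSiegel, §7 Prop 7.1 (7.2) p.44] -/
theorem rplusplus12_verdict_lambdaWhole (θ : ℝ) (u u' : ℝ → ℂ) (L : KnifeEdge.LambdaPiece) (v' : ℝ → ℂ) (c : ℂ)
    (hu : KinkedProfile u u') (hu1 : u 1 = 0) (hL : L.Whole θ v') (K : KnifeEdge.LambdaDiag) (X : KnifeEdge.LambdaCross)
    (hK : KnifeEdge.LambdaWholeDiagNonneg θ K) (hX : KnifeEdge.LambdaWholeCS θ K X) :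
    ¬ (KnifeEdge.lambdaBlockMainTerm K X u u' L c < 0) :=
  familyLambdaWholeAll_decided ⟨θ, u, u', L, v', c⟩ ⟨hu, hu1, hL⟩ K X hK hX

/-- **Unbundled reading of row 40** (every binder literal): for every anchor `a ∈ (0,1)`, palette `b` in `(0,5)`, one-sided
kinked profile vector `h` (`h j 1 = 0`), GIVEN the E-102 member `ConePSD a b`, the entangled detector's main-term constant is
not negative. [cite: Zhang2022LandauSiegel, §2 (2.16), (2.32); §7 Prop 7.1 (7.2) p.44] -/
theorem rplusplus12_verdict_detEntangled {K : ℕ} (a : ℝ) (b : Fin K → ℝ) (h h' : Fin K → ℝ → ℂ)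
    (ha : 0 < a ∧ a < 1) (hb : ∀ j, 0 < b j ∧ b j < 5) (hh : ∀ j, KinkedProfile (h j) (h' j)) (h1 : ∀ j, h j 1 = 0)
    (hP : Det.ConePSD a b) : ¬ ((Det.entangledMain a b h h').re < 0) :=
  familyDetEntangled_decided ⟨K, a, b, h, h'⟩ ⟨ha, hb, hh, h1⟩ hP

/-- **Rows 25 and 39 are nested** (bookkeeping for «counted once»): every row-25 design is a row-39 design
(`LambdaOverhangDesign.toWhole`, class preserved) and row 39's slots imply row 25's
(`LambdaWholeDiagNonneg.overhang`, `LambdaWholeCS.overhang`). [cite: Zhang2022LandauSiegel, §7 (7.2) p.44] -/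
theorem lambdaOverhang_into_whole :
    (∀ d : LambdaOverhangDesign, d.InClass → familyLambdaWholeAll.InClass d.toWhole) ∧
      (∀ (θ : ℝ) (K : KnifeEdge.LambdaDiag) (X : KnifeEdge.LambdaCross),
        KnifeEdge.LambdaWholeDiagNonneg θ K → KnifeEdge.LambdaWholeCS θ K X →
          KnifeEdge.LambdaOverhangDiagNonneg θ K ∧ KnifeEdge.LambdaOverhangCS θ K X) :=
  ⟨fun _ hd => hd.toWhole, fun _ _ _ hK hX => ⟨hK.overhang, hX.overhang⟩⟩

/-! ### Version 12, addendum (B-det intake v2): `bdetWord2` is inside the class of record — no new family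

INTAKE-4 Part 2 (RepairIntakeBdet, ls-Bdet-typer-2 g2, p477601; second read ls-Bmulti-typer-2 g3 00:14:50Z): `Repair.bdetWord2 :=
bdetWord ++ [familyDetEntangled]` — rows 17 / 2 / 6 / 40 of version 12; sum family `familyBdet2` (constructor `entangled`), never a
row. With this lemma every constructor of all three design-class words' CURRENT intake lists (B-multi v6, B-len v4, B-det v2)
dispatches to a row of `Rplusplus12`. -/

/-- **The KILL(B-det) intake list v2 is inside version 12** (rows 17 / 2 / 6 / 40).
[cite: Zhang2022LandauSiegel, §2 (2.13), (2.16), Lemma 2.3, (2.32)–(2.33)] -/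
theorem bdetWord2_sub_rplusplus12 : ∀ F ∈ bdetWord2, F ∈ Rplusplus12 := by
  intro F hF
  rcases List.mem_append.1 hF with h | h
  · exact bdetWord_sub_rplusplus12 F h
  · simp only [List.mem_cons, List.not_mem_nil, or_false] at h
    rw [mem_rplusplus12_iff]
    tauto

/-- … hence `bdetWord2_decided` is an instance of `rplusplus12_decided`. [cite: Zhang2022LandauSiegel, §2 (2.32)–(2.33)] -/
theorem rplusplus12_decided_bdetWord2 : ClassDecided bdetWord2 := rplusplus12_decided.mono bdetWord2_sub_rplusplus12

/-- **The three words' CURRENT intake lists (v6 / v4 / v2) are inside version 12.**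
[cite: Zhang2022LandauSiegel, §2 (2.32)–(2.33); §7 Prop 7.1 (7.2) p.44] -/
theorem rplusplus12_words_sub_current :
    (∀ F ∈ bmultiWord6, F ∈ Rplusplus12) ∧ (∀ F ∈ blenWord4, F ∈ Rplusplus12) ∧ (∀ F ∈ bdetWord2, F ∈ Rplusplus12) :=
  ⟨rplusplus12_words_sub.1, blenWord4_sub_rplusplus12, bdetWord2_sub_rplusplus12⟩

/-- … and their sum families are decided: `R⁺ ++ [familyBmulti6, familyBlen4, familyBdet2]`.
[cite: Zhang2022LandauSiegel, §2 (2.32)–(2.33)] -/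
theorem rplus_threeWords_asFamilies_decided_current : ClassDecided (Rplus ++ [familyBmulti6, familyBlen4, familyBdet2]) :=
  classDecided_append.2 ⟨rplus_decided, classDecided_cons familyBmulti6_decided <|
    classDecided_cons familyBlen4_decided <| classDecided_cons familyBdet2_decided classDecided_nil⟩

/-! ### Version 13 (2026-08-27): the BAND MEAN-VALUE rows — E-004 narrowed to the large-sieve-type slot E-004′ (p2 g3)

| # | family (decl) | designs, K in words | V (currency) | displayed inputs (kind) | p-id (file) | non-vacuity / tightness / embeddings |
|---|---|---|---|---|---|---|
| 41 «wall0, band MV» | `familyWallZeroBandMV` | `WallZeroDesign (c′, g)` = rows 12/22/35 UNCHANGED (globally 1-Lipschitz, `‖g‖∞ ≤ 1`, `g(1) = 0`; from the wall to any bounded length) | discrete mean, CLEAN main-scale form: ∀ `δ > 0` ∀ `η > 0` ∀ `κ < 6`, GIVEN `BandMeanValue c′ 1078 κ` and the manuscript's nodes Prop 7.1 / Lemma 8.1 / Prop 2.2 (i) / Lemma 2.3, for all large `D`, under (A) and (b), for EVERY `⌈P⌉ ≤ N ≤ ⌈P^{1+δ}⌉`: `¬ (η·(discMeanAbs⌈P⌉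 + 𝔞𝔓) < |discMean N − discMean ⌈P⌉|)` | ONE analytic slot, kind (c): `Repair.BandMeanValue c′ 1078 κ` = E-004′(κ), a weighted LARGE-SIEVE-TYPE mean-value bound on the true band (`κ < 6`), from which E-004 follows (`RepairBandMeanValue`, p477210: E-004 ⇐ E-004′); `Skeleton.Prop71`, `Lemma81`, `Prop22i`, `Lemma23` and (A) displayed as the manuscript's own nodes · `Re ρ = ½` (b) | p477819 (`RepairRplusBandMV`, ls-barrier-p2 g3; ls-barrier-plan g1 RULING 00:21:36Z) ← p477210, p470415 | SUPERSEDE rows 35–38 FOR COVERAGE «weaker displayed slot, same designs» — all rows kept; the NOT-COVERED ledger's true-band seam N1 is NARROWED to E-004′ (not closed); C4 `familyWallZeroBandMV_inClass_triangle`; REF-E candidates E-26 (reduction) / E-27 (rows) |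
| 42 «wall0top, band MV» | `familyWallZeroTopBandMV` | `WallZeroTopDesign` = rows 13/23/36 UNCHANGED | same, FULL polynomial (every `N ≥ ⌈P⌉`) | as row 41 | p477819 | as row 41 |
| 43 «glued wall0, band MV» | `familySmoothWallZeroBandMV` | `SmoothDesign` with `d.InClass ∧ g(1) = 0` = row 37's class LITERALLY (`familySmoothWallZeroBandMV_inClass_iff`): ANY bulk below the wall, `K`-Lipschitz `‖·‖ ≤ M` overhang | same clean form for the glued class `(K, M)`, bounded lengths | as row 41 (slot at `(K, M)` via `discMean_fromWall_of_bandMeanValue`) | p477819 | C2 `familySmoothWallZeroBandMV_members` (the wall-zero designs with `K = M = 1`); supersedes row 37 for coverage |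
| 44 «glued wall0top, band MV» | `familySmoothTopWallZeroBandMV` | `SmoothTopDesign` with `d.InClass ∧ g(1) = 0` = row 38's class (`familySmoothTopWallZeroBandMV_inClass_iff`) | same, FULL polynomial | as row 41 | p477819 | supersedes row 38 for coverage; `rplus_bandMV_decided` is the slice file's `R⁺ ++ [41, 42, 43, 44]` |

Words: no change — the three design-class intake lists of record (current: `bmultiWord6`, `blenWord4`, `bdetWord2`) stay sub-lists
(`rplusplus13_words_sub`); `bfamWord` separate; B-dh a target. Class of record before this version = `Rplusplus12` (p477072 +
addendum p477884). -/

/-- **`R⁺⁺`, version 13**: version 12 followed by the four BAND MEAN-VALUE families (`familyWallZeroBandMV`,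
`familyWallZeroTopBandMV`, `familySmoothWallZeroBandMV`, `familySmoothTopWallZeroBandMV`, p477819) — rows 41–44: the
wall-zero classes (global / glued, bounded / full) with E-004 replaced by the large-sieve-type slot E-004′.
[cite: Zhang2022LandauSiegel, §2 (2.16)–(2.20), (2.30)–(2.33); §7 Prop 7.1; §8 Lemma 8.1] -/
def Rplusplus13 : List DesignFamily :=
  Rplusplus12 ++ [familyWallZeroBandMV, familyWallZeroTopBandMV, familySmoothWallZeroBandMV, familySmoothTopWallZeroBandMV]

/-- **Version 13 is decided**: `rplusplus12_decided` for rows 1–40 and the four landed `…_decided` theorems (p477819) for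
rows 41–44; nothing re-proved. [cite: Zhang2022LandauSiegel, §2 Props. 2.4–2.6, (2.16)–(2.20), (2.32)–(2.33); §8 Lemma 8.1] -/
theorem rplusplus13_decided : ClassDecided Rplusplus13 :=
  classDecided_append.2 ⟨rplusplus12_decided,
    classDecided_cons familyWallZeroBandMV_decided <| classDecided_cons familyWallZeroTopBandMV_decided <|
      classDecided_cons familySmoothWallZeroBandMV_decided <|
        classDecided_cons familySmoothTopWallZeroBandMV_decided classDecided_nil⟩

/-- The families of version 13, by name (the class is EXACTLY these forty-four).
[cite: Zhang2022LandauSiegel, §2 (2.32)–(2.33)] -/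
theorem mem_rplusplus13_iff (F : DesignFamily) :
    F ∈ Rplusplus13 ↔ F = familyR ∨ F = familyH1 ∨ F = familyTwoPiece ∨ F = familyFarPiece ∨
      F = familyRWide ∨ F = familyRCalc ∨ F = KnifeEdge.familyRoughTwoPiece ∨ F = familyRLengths ∨
      F = familySmoothLengths ∨ F = familySmoothTop ∨ F = familyTwoPieceJoint ∨ F = familyWallZero ∨
      F = familyWallZeroTop ∨ F = familyInPrintLen ∨ F = KnifeEdge.familyWallBand ∨ F = familyJumpBlockAll ∨
      F = familyDetShift ∨ F = KnifeEdge.familyRoughThreePiece ∨ F = KnifeEdge.familyRoughTwoPieceJoint ∨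
      F = familyFarBV ∨ F = familyLambdaBlockAll ∨ F = familyWallZeroMain ∨ F = familyWallZeroTopMain ∨
      F = KnifeEdge.familyGramBlockAll ∨ F = familyLambdaOverhangAll ∨ F = familyLambdaGradedAll ∨
      F = KnifeEdge.familyGramBlockDict ∨ F = KnifeEdge.familyGramBordered ∨ F = familyMuPsiOverhangAll ∨
      F = familyNuOverhangAll ∨ F = familyBandEdge ∨ F = familySmoothBandEdge ∨ F = familySmoothTopBandEdge ∨
      F = familyNuLipOverhangAll ∨ F = familyWallZeroTrueBand ∨ F = familyWallZeroTopTrueBand ∨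
      F = familySmoothWallZeroTrueBand ∨ F = familySmoothTopWallZeroTrueBand ∨ F = familyLambdaWholeAll ∨
      F = familyDetEntangled ∨ F = familyWallZeroBandMV ∨ F = familyWallZeroTopBandMV ∨
      F = familySmoothWallZeroBandMV ∨ F = familySmoothTopWallZeroBandMV := by
  simp only [Rplusplus13, Rplusplus12, Rplusplus11, Rplusplus10, Rplusplus9, Rplusplus8, Rplusplus7, Rplusplus6,
    Rplusplus5, Rplusplus4, Rplusplus3, Rplusplus2, Rplusplus1, Rplus, List.cons_append, List.nil_append, List.mem_cons,
    List.not_mem_nil, or_false]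

/-- **Version 12 ⊆ version 13** (list prefix: no family dropped). [cite: Zhang2022LandauSiegel, §2 (2.32)–(2.33)] -/
theorem rplusplus12_sub_rplusplus13 : ∀ F ∈ Rplusplus12, F ∈ Rplusplus13 :=
  fun _ hF => List.mem_append.2 (Or.inl hF)

/-- `R⁺ ⊆` version 13. [cite: Zhang2022LandauSiegel, §2 (2.32)–(2.33)] -/
theorem rplus_sub_rplusplus13 : ∀ F ∈ Rplus, F ∈ Rplusplus13 :=
  fun F hF => rplusplus12_sub_rplusplus13 F (rplus_sub_rplusplus12 F hF)

/-- Version 13 restricted to version 12, and the slice file's own `R⁺ ++ [41, 42, 43, 44]` (`rplus_bandMV_decided`) as a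
sub-list. [cite: Zhang2022LandauSiegel, §2 (2.32)–(2.33)] -/
theorem rplusplus13_decided_sublists :
    ClassDecided Rplusplus12 ∧
      ClassDecided (Rplus ++ [familyWallZeroBandMV, familyWallZeroTopBandMV, familySmoothWallZeroBandMV,
        familySmoothTopWallZeroBandMV]) := by
  refine ⟨rplusplus13_decided.mono rplusplus12_sub_rplusplus13, rplusplus13_decided.mono fun F hF => ?_⟩
  rcases List.mem_append.1 hF with h | h
  · exact rplus_sub_rplusplus13 F h
  · simp only [List.mem_cons, List.not_mem_nil, or_false] at h
    rw [mem_rplusplus13_iff]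
    tauto

/-- **The three design-class words' current intake lists are inside version 13** (B-multi v6, B-len v4, B-det v2; inherited).
[cite: Zhang2022LandauSiegel, §2 (2.32)–(2.33)] -/
theorem rplusplus13_words_sub :
    (∀ F ∈ bmultiWord6, F ∈ Rplusplus13) ∧ (∀ F ∈ blenWord4, F ∈ Rplusplus13) ∧ (∀ F ∈ bdetWord2, F ∈ Rplusplus13) :=
  ⟨fun F hF => rplusplus12_sub_rplusplus13 F (rplusplus12_words_sub_current.1 F hF),
    fun F hF => rplusplus12_sub_rplusplus13 F (rplusplus12_words_sub_current.2.1 F hF),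
    fun F hF => rplusplus12_sub_rplusplus13 F (rplusplus12_words_sub_current.2.2 F hF)⟩

/-- `bdetWord2 ⊆ Rplusplus13` by name (the planner's books ask for it under this name).
[cite: Zhang2022LandauSiegel, §2 (2.32)–(2.33)] -/
theorem bdetWord2_sub_rplusplus13 : ∀ F ∈ bdetWord2, F ∈ Rplusplus13 := rplusplus13_words_sub.2.2

/-- **The band-MV rows have EXACTLY the classes of the true-band rows** (35/41 and 36/42 on the global class, 37/43 and
38/44 on the glued class): only the displayed slot changed (E-004 true band ⟶ E-004′ large-sieve type) — the bookkeeping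
behind «41–44 supersede 35–38 for coverage; all kept». [cite: Zhang2022LandauSiegel, §2 (2.16)–(2.20)] -/
theorem bandMV_sameClass :
    (∀ d : WallZeroDesign, familyWallZeroBandMV.InClass d ↔ familyWallZeroTrueBand.InClass d) ∧
      (∀ d : WallZeroTopDesign, familyWallZeroTopBandMV.InClass d ↔ familyWallZeroTopTrueBand.InClass d) ∧
      (∀ d : SmoothDesign, familySmoothWallZeroBandMV.InClass d ↔ familySmoothWallZeroTrueBand.InClass d) ∧
      (∀ d : SmoothTopDesign, familySmoothTopWallZeroBandMV.InClass d ↔ familySmoothTopWallZeroTrueBand.InClass d) :=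
  ⟨fun _ => Iff.rfl, fun _ => Iff.rfl, familySmoothWallZeroBandMV_inClass_iff, familySmoothTopWallZeroBandMV_inClass_iff⟩

/-- **Unbundled reading of rows 41–44** (every class binder literal): the four band-MV verdicts.
[cite: Zhang2022LandauSiegel, §2 (2.16)–(2.20), (2.30)–(2.31); §7 Prop 7.1; §8 Lemma 8.1] -/
theorem rplusplus13_verdicts :
    (∀ (c' : ℝ) (g : ℝ → ℂ), LipschitzWith 1 g → (∀ z, ‖g z‖ ≤ 1) → g 1 = 0 → (WallZeroDesign.mk c' g).VerdictBandMV) ∧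
    (∀ (d : WallZeroDesign) (θ : ℝ), d.InClass → (∀ z, θ ≤ z → d.g z = 0) → (WallZeroTopDesign.mk d θ).VerdictBandMV) ∧
    (∀ d : SmoothDesign, d.InClass → d.g 1 = 0 → d.VerdictBandMV) ∧
    (∀ d : SmoothTopDesign, d.InClass → d.g 1 = 0 → d.VerdictBandMV) :=
  ⟨fun c' g h1 h2 h3 => familyWallZeroBandMV_decided ⟨c', g⟩ ⟨h1, h2, h3⟩,
    fun d θ hd hθ => familyWallZeroTopBandMV_decided ⟨d, θ⟩ ⟨hd, hθ⟩,
    fun d h h0 => familySmoothWallZeroBandMV_decided d ⟨h, h0⟩,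
    fun d h h0 => familySmoothTopWallZeroBandMV_decided d ⟨h, h0⟩⟩

end Repair

end Literature.NumberTheory.LFunctions.Zhang2022
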